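import Mathlib
import HarnessLib
import Literature.NumberTheory.EllipticCurves.HalfIntegralWeightGaussSums

/-!
# Gauss-sum regrouping of quadratic phases and the bound (7.4.2) (towards Graham–Kolesnik, Lemma 7.16)

Topic `Literature/NumberTheory/LFunctions`. Graham–Kolesnik, *Van der Corput's Method of Exponential
Sums* (LMS LN 126, CUP 1991), §7.4 "Gauss sums": with `G(a, l; c) = ∑_{d mod c} e((ad² + ld)/c)`
(7.4.1) — the tree's `Literature.NumberTheory.EllipticCurves.ModularForms.quadGaussSum c a l` —
"we shall show that if `(a, c) = 1` then `|G(a, l; c)| ≤ (2c)^{1/2}`" (7.4.2), and the first step of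
the proof of Lemma 7.16 (p. 66): splitting `∑_n g(n) e(μn³ + (an² + bn)/c)` according to `n mod c`
and detecting the residue class by additive characters, which produces the Gauss sums
`G(a, b + h; c)` as coefficients.

Both are PROVED here, in a form ready for the cubic sums:
* `CubicSum.sum_quadPhase_mul_eq` — for any finite set of integers `n` and weights `F(n)`,
  `∑_n e((an² + bn)/c) F(n) = c⁻¹ ∑_{k mod c} G(a, b - k; c) ∑_n F(n) e(kn/c)` (orthogonality
  `∑_{k mod c} e(km/c) = c·[m ≡ 0]`, `CubicSum.sum_stdAddChar_mul`, from Mathlib's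
  `AddChar.sum_mulShift` for the primitive character `ZMod.stdAddChar`);
* `CubicSum.normSq_quadGaussSum_le`, `CubicSum.norm_quadGaussSum_le_sqrt` — (7.4.2) for `a` a unit
  modulo `c`: `|G|² = c ∑_{2ah ≡ 0} e((ah² + lh)/c)` by squaring (as in `KloostermanSalie.lean` for
  prime moduli), and `2h ≡ 0 (mod c)` has at most the two solutions `0`, `c/2`
  (`CubicSum.two_mul_eq_zero_iff_mem`). Graham–Kolesnik prove (7.4.2) via the multiplicativity and
  the evaluation of `G` at prime powers (Lemmas 7.10–7.15); the squaring argument gives the same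
  bound directly (with equality `|G|² = c` for odd `c`).

## References

* S. W. Graham, G. Kolesnik, *Van der Corput's Method of Exponential Sums*, LMS Lecture Note Series
  126, Cambridge Univ. Press 1991 — §7.4, (7.4.1)–(7.4.2) (p. 64); Lemma 7.16 (proof, p. 66).
  [GrahamKolesnik1991]
-/

noncomputable section

open Complex Finset

namespace Literature.NumberTheory.LFunctions
namespace CubicSum

open Literature.NumberTheory.EllipticCurves.ModularForms (quadGaussSum quadGaussSum_def)

variable {c : ℕ} [NeZero c]

/-- Orthogonality of the additive characters modulo `c`: `∑_{k mod c} e(km/c) = c·[m = 0]`.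
[folklore] -/
theorem sum_stdAddChar_mul (m : ZMod c) :
    ∑ k : ZMod c, (ZMod.stdAddChar (k * m) : ℂ) = if m = 0 then (c : ℂ) else 0 := by
  classical
  rw [AddChar.sum_mulShift m (ZMod.isPrimitive_stdAddChar c), ZMod.card]
  split_ifs <;> simp

/-- **Regrouping by residue classes** (Graham–Kolesnik, proof of Lemma 7.16, first two displays):
`∑_n e((an² + bn)/c) F(n) = c⁻¹ ∑_{k mod c} G(a, b - k; c) ∑_n F(n) e(kn/c)` for any finite set of
integers `n` and weights `F`, `G(a, l; c) = ∑_{d mod c} e((ad² + ld)/c)` (`quadGaussSum c a l`).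
[cite: GrahamKolesnik1991, Lemma 7.16 (proof)] -/
theorem sum_quadPhase_mul_eq (a b : ℤ) (S : Finset ℤ) (F : ℤ → ℂ) :
    ∑ n ∈ S, (ZMod.stdAddChar (((a * n ^ 2 + b * n : ℤ) : ZMod c)) : ℂ) * F n =
      (1 / (c : ℂ)) * ∑ k : ZMod c, quadGaussSum c a ((b : ZMod c) - k) *
        ∑ n ∈ S, F n * (ZMod.stdAddChar (k * (n : ZMod c)) : ℂ) := by
  classical
  set ψ : ZMod c → ℂ := fun x => (ZMod.stdAddChar x : ℂ) with hψ
  have hc : (c : ℂ) ≠ 0 := by exact_mod_cast (NeZero.ne c)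
  -- expand the right-hand side
  have h1 : ∀ k : ZMod c, quadGaussSum c a ((b : ZMod c) - k) * ∑ n ∈ S, F n * ψ (k * n) =
      ∑ n ∈ S, F n * ∑ d : ZMod c, ψ ((a : ZMod c) * d ^ 2 + (b : ZMod c) * d + k * ((n : ZMod c) - d)) := by
    intro k
    rw [quadGaussSum_def, Finset.sum_mul]
    simp_rw [Finset.mul_sum]
    rw [Finset.sum_comm]
    refine Finset.sum_congr rfl fun n _ => ?_
    refine Finset.sum_congr rfl fun d _ => ?_
    simp only [hψ]
    rw [mul_left_comm, ← AddChar.map_add_eq_mul]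
    congr 2
    ring
  have h2 : ∑ k : ZMod c, quadGaussSum c a ((b : ZMod c) - k) * ∑ n ∈ S, F n * ψ (k * n) =
      ∑ n ∈ S, F n * ∑ d : ZMod c, ψ ((a : ZMod c) * d ^ 2 + (b : ZMod c) * d) *
        ∑ k : ZMod c, ψ (k * ((n : ZMod c) - d)) := by
    simp only [h1]
    rw [Finset.sum_comm]
    refine Finset.sum_congr rfl fun n _ => ?_
    rw [← Finset.mul_sum, Finset.sum_comm]
    congr 1
    refine Finset.sum_congr rfl fun d _ => ?_
    rw [Finset.mul_sum]
    refine Finset.sum_congr rfl fun k _ => ?_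
    simp only [hψ]
    rw [← AddChar.map_add_eq_mul]
  have h3 : ∀ n : ℤ, ∑ d : ZMod c, ψ ((a : ZMod c) * d ^ 2 + (b : ZMod c) * d) *
      ∑ k : ZMod c, ψ (k * ((n : ZMod c) - d)) = (c : ℂ) * ψ ((a : ZMod c) * n ^ 2 + (b : ZMod c) * n) := by
    intro n
    simp only [hψ, sum_stdAddChar_mul, sub_eq_zero, mul_ite, mul_zero]
    rw [Finset.sum_ite_eq Finset.univ ((n : ℤ) : ZMod c), if_pos (Finset.mem_univ _)]
    ring
  show ∑ n ∈ S, ψ (((a * n ^ 2 + b * n : ℤ) : ZMod c)) * F n =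
      (1 / (c : ℂ)) * ∑ k : ZMod c, quadGaussSum c a ((b : ZMod c) - k) * ∑ n ∈ S, F n * ψ (k * n)
  rw [h2]
  simp only [h3]
  rw [Finset.mul_sum]
  refine Finset.sum_congr rfl fun n _ => ?_
  have : (((a * n ^ 2 + b * n : ℤ) : ZMod c)) = (a : ZMod c) * n ^ 2 + (b : ZMod c) * n := by push_cast; ring
  rw [this]
  field_simp

/-- The elements of order `≤ 2` in `ℤ/cℤ` are `0` and `c/2`. [folklore] -/
theorem two_mul_eq_zero_iff_mem (h : ZMod c) (h2 : 2 * h = 0) : h = 0 ∨ h = ((c / 2 : ℕ) : ZMod c) := by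
  have hc : 0 < c := Nat.pos_of_ne_zero (NeZero.ne c)
  have hv : h.val < c := ZMod.val_lt h
  have hdvd : c ∣ 2 * h.val := by
    have : ((2 * h.val : ℕ) : ZMod c) = 0 := by push_cast; rw [ZMod.natCast_zmod_val]; exact h2
    exact (ZMod.natCast_eq_zero_iff _ _).1 this
  obtain ⟨m, hm⟩ := hdvd
  have hm2 : m < 2 := by nlinarith
  interval_cases m
  · left
    have : h.val = 0 := by omega
    rw [← ZMod.natCast_zmod_val h, this, Nat.cast_zero]
  · right
    have : h.val = c / 2 := by omega
    rw [← ZMod.natCast_zmod_val h, this]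

/-- **Graham–Kolesnik (7.4.2)**: `|G(a, l; c)|² ≤ 2c` when `a` is a unit modulo `c`
(`|G|² = ∑_h e((ah² + lh)/c) ∑_{t} e(2ah t/c) = c ∑_{2ah ≡ 0} e((ah² + lh)/c)`, and `2h ≡ 0 (mod c)`
has at most the two solutions `0`, `c/2`). [cite: GrahamKolesnik1991, eq. (7.4.2)] -/
theorem normSq_quadGaussSum_le {a : ZMod c} (ha : IsUnit a) (l : ZMod c) :
    ‖quadGaussSum c a l‖ ^ 2 ≤ 2 * c := by
  classical
  set ψ : ZMod c → ℂ := fun x => (ZMod.stdAddChar x : ℂ) with hψ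
  set f : ZMod c → ZMod c := fun t => a * t ^ 2 + l * t with hf
  set G : ℂ := ∑ t : ZMod c, ψ (f t) with hG
  have hGdef : quadGaussSum c a l = G := by rw [quadGaussSum_def]
  rw [hGdef]
  have hconj : starRingEnd ℂ G = ∑ t : ZMod c, ψ (-f t) := by
    rw [hG, map_sum]
    exact Finset.sum_congr rfl fun t _ => (AddChar.map_neg_eq_conj ZMod.stdAddChar (f t)).symm
  have hkey : G * starRingEnd ℂ G =
      ∑ h : ZMod c, ψ (a * h ^ 2 + l * h) * (if 2 * a * h = 0 then (c : ℂ) else 0) := by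
    rw [hconj, hG, Finset.sum_mul_sum]
    have h1 : ∑ t : ZMod c, ∑ t' : ZMod c, ψ (f t) * ψ (-f t') =
        ∑ t' : ZMod c, ∑ h : ZMod c, ψ (f (t' + h) - f t') := by
      rw [Finset.sum_comm]
      refine Finset.sum_congr rfl fun t' _ => ?_
      refine (Fintype.sum_equiv (Equiv.addLeft t') (fun h => ψ (f (t' + h) - f t'))
        (fun t => ψ (f t) * ψ (-f t')) fun h => ?_).symm
      simp only [Equiv.coe_addLeft, hψ]
      rw [← AddChar.map_add_eq_mul, sub_eq_add_neg]
    have h2 : ∀ t' h : ZMod c, f (t' + h) - f t' = t' * (2 * a * h) + (a * h ^ 2 + l * h) := by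
      intro t' h; simp only [hf]; ring
    rw [h1, Finset.sum_comm]
    refine Finset.sum_congr rfl fun h _ => ?_
    rw [← sum_stdAddChar_mul (2 * a * h), Finset.mul_sum]
    refine Finset.sum_congr rfl fun t' _ => ?_
    rw [h2, hψ]
    dsimp only
    rw [AddChar.map_add_eq_mul, mul_comm]
  -- bound
  have hnsq : ‖G‖ ^ 2 = ‖G * starRingEnd ℂ G‖ := by
    rw [norm_mul, Complex.norm_conj, sq]
  rw [hnsq, hkey]
  have hterm : ∀ h : ZMod c, ‖ψ (a * h ^ 2 + l * h) * (if 2 * a * h = 0 then (c : ℂ) else 0)‖ =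
      if 2 * h = 0 then (c : ℝ) else 0 := by
    intro h
    have hiff : 2 * a * h = 0 ↔ 2 * h = 0 := by
      rw [mul_comm 2 a, mul_assoc]
      exact ha.mul_right_eq_zero
    by_cases h0 : 2 * h = 0
    · rw [if_pos (hiff.2 h0), if_pos h0, norm_mul, hψ]
      dsimp only
      rw [AddChar.norm_apply, one_mul, Complex.norm_natCast]
    · rw [if_neg (mt hiff.1 h0), if_neg h0, mul_zero, norm_zero]
  calc ‖∑ h : ZMod c, ψ (a * h ^ 2 + l * h) * (if 2 * a * h = 0 then (c : ℂ) else 0)‖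
      ≤ ∑ h : ZMod c, ‖ψ (a * h ^ 2 + l * h) * (if 2 * a * h = 0 then (c : ℂ) else 0)‖ := norm_sum_le _ _
    _ = ∑ h : ZMod c, (if 2 * h = 0 then (c : ℝ) else 0) := Finset.sum_congr rfl fun h _ => hterm h
    _ = ((Finset.univ.filter fun h : ZMod c => 2 * h = 0).card : ℝ) * c := by
        rw [Finset.sum_ite, Finset.sum_const_zero, add_zero, Finset.sum_const, nsmul_eq_mul]
    _ ≤ 2 * c := by
        gcongr
        have hsub : (Finset.univ.filter fun h : ZMod c => 2 * h = 0) ⊆ {0, ((c / 2 : ℕ) : ZMod c)} := by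
          intro h hh
          rw [Finset.mem_filter] at hh
          rcases two_mul_eq_zero_iff_mem h hh.2 with e | e <;> simp [e]
        have := (Finset.card_le_card hsub).trans (Finset.card_le_two)
        exact_mod_cast this

/-- `|G(a, l; c)| ≤ √(2c)`. [cite: GrahamKolesnik1991, eq. (7.4.2)] -/
theorem norm_quadGaussSum_le_sqrt {a : ZMod c} (ha : IsUnit a) (l : ZMod c) :
    ‖quadGaussSum c a l‖ ≤ Real.sqrt (2 * c) := by
  rw [← Real.sqrt_sq (norm_nonneg _)]
  exact Real.sqrt_le_sqrt (normSq_quadGaussSum_le ha l)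

end CubicSum
end Literature.NumberTheory.LFunctions
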